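import Literature.AlgebraicGeometry.ShimuraVarieties.UnitaryShimuraCurveRecord
import Literature.AlgebraicGeometry.ModuliOfAbelianVarieties.SiegelRationalTransporterFinite
import Literature.AlgebraicGeometry.ModuliOfAbelianVarieties.SiegelPrincipalLevelOpen
import Literature.Topology.Algebra.CompactMulInterAntitone
import HarnessLib

/-!
# Tower separation of the Siegel point map of the unitary Shimura curve ([Deligne 1971] Prop. 1.15 at infinite level)

Topic `AlgebraicGeometry/ShimuraVarieties`; namespace `Literature.AlgebraicGeometry.ShimuraVarieties.UnitaryCurve`.
THEOREMS ONLY (no `def`, no named fact, no instance, no `sorry`).  Cell `hodgecm-mathlib`, crux HLiu418 (stmt-HodgeConjecture-24832),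
sub-line P6a, E-line `F0_P6a_PELWitnessE`, organ **E3 FILE B** (LEAD F0P6-plan (g2) 2026-09-01T21:45:42Z ∕ 21:55:39Z (3)(G2)): the sister of
`UnitaryCurveSiegelPointMap` (FILE A: the class map `φ_N : [v, aK] ↦ [J(v), b(a)·K_δ(N)]` is well defined and is the Siegel Shimura-set shadow
`pts ∘ f` of the moduli point map).  Here: the INJECTIVITY content the datum affords BEFORE algebraicity — separation along the factorial
tower of principal levels — the rank-2 twin of the cell's rank-3 ★ `shimuraSet_mk_eq_and_classOf_eq_of_forall_siegel_mk_eq`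
(`UnitaryAuxiliarySiegelInjectivity`, [Deligne1971TravauxShimura] Prop. 1.15 at infinite level) with the torus class dropped (the datum on the
cone has `γ`-only relations).  Finite-level injectivity of the point map is FALSE for a general small level and is obtained AFTER GAGA (E4) by
Deligne's Noetherian stationarity (★ `Motives.exists_injective_map_of_iInter_eq_diagonal`) from the separation proved here.

THE DATUM (hypotheses; cf. FILE A): `J : (Fin 2 → ℂ) → M_{2g}(ℝ)` valued in `S^±` on the negative cone of `J⋆^τ` (`hJ`), SEPARATING PUNCTURED
LINES (`hJinj : J v = J v′ → v ∈ ℂˣ·v′`, E2 ★ `…ComplexStructureInjective` twin); a CONTINUOUS group map `b : U(J⋆)(𝔸_{L⁺,f}) → GSp_δ(𝔸_f)`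
(`hbcont`, ★ `continuous_auxToGspFinV`) with rational companion `bq`, equivariance `hJrat`, and RATIONAL POINTS OF THE IMAGE
(`hbrat : (bq? γ)_𝔸 = b x ⇒ x = β_𝔸 ∧ γ = bq β`, E1 ★ `exists_auxToGspRat_eq_of_gspRationalToFinAdelic_eq` twin); a COMPACT source level
`K ≤ b⁻¹(K_δ(N))`, `N ≠ 0`.

WHAT IS PROVED.
* `gs_mk_eq_of_forall_siegel_mk_eq` — if for EVERY `k` the Siegel classes at level `K_δ(N·(k+1)!)` of `(J v, b a)` and of `(J v′, b a′ · b u_k)`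
  for SOME `u_k ∈ K` agree, then `[v, aK] = [v′, a′K]` in `Sh_K(U(J⋆), 𝔻)(ℂ)`.  Ingredients BY NAME: the finite rational transporter
  ★ `finite_setOf_conjAct_eq_and_mem` (pigeonhole: one `γ₀ ∈ GSp_δ(ℚ)` serves cofinally many levels), compact · shrinking levels
  ★ `Literature.Topology.Algebra.mem_of_forall_mem_mul_of_isCompact` with ★ `iInter_principalLevelSubgroup_factorial` (`b(a)⁻¹γ₀b(a′) ∈ b(K)`),
  `hbrat` (`γ₀ = bq β`), `hJrat` + `hJinj` (`β^τ v′ ∈ ℂˣ v`).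
* `gs_mk_eq_of_forall_siegel_mk_eq'` — the `u_k = 1` form: classes of `(J v, b a)`, `(J v′, b a′)` agreeing at every `K_δ(N(k+1)!)` are equal.
* `eq_of_forall_siegelPointMap_eq` — the same for ANY family of class maps `φ_k : Sh_K(ℂ) → Sh_{K_δ(N(k+1)!)}(ℂ)` with FILE A's formula
  (`⋂ₖ {φ_k x = φ_k y} = Δ`, the input of ★ `Motives.exists_injective_map_of_iInter_eq_diagonal`).

HC_CM is proved only modulo the 2 remaining named inputs (hLiu418 24832, h413 24833) until rung 0 closes; this file discharges neither
(count-neutral support of 24832).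

## References
* [Deligne1971TravauxShimura] P. Deligne, *Travaux de Shimura*, Sém. Bourbaki 389 (1971), Prop. 1.15 and Lemme 1.15.3 p. 132; 5.4.
* [Deligne1979ShimuraVarieties] P. Deligne, *Variétés de Shimura* (1979), Prop. 2.3.10, 2.1.2.
* [Milne2005ShimuraVarieties] J. S. Milne, *Introduction to Shimura varieties* (2005), Lemma 5.13 p. 57, Thm. 5.16, §6 p. 68.
* [RapoportSmithlingZhang2020Diagonal] M. Rapoport, B. Smithling, W. Zhang (2020), §3.2 (3.10) and Prop. 3.7 (proof) pp. 11–14.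
-/

set_option autoImplicit false

noncomputable section

open Function Matrix NumberField IsDedekindDomain
open scoped Matrix ComplexOrder Pointwise
open Literature.NumberTheory.Automorphic.UnitaryGroup
open Literature.AlgebraicGeometry.ModuliOfAbelianVarieties

namespace Literature.AlgebraicGeometry.ShimuraVarieties

open UnitaryCanonicalModel

namespace UnitaryCurve

variable {L : Type} [Field L] [NumberField L] [IsCMField L] {Jstar : Matrix (Fin 2) (Fin 2) L} {τ : L →+* ℂ}
variable {g : ℕ} {δ : Fin g → ℕ} {N : ℕ}
variable (J : (Fin 2 → ℂ) → Matrix (Fin g ⊕ Fin g) (Fin g ⊕ Fin g) ℝ)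
  (hJ : ∀ v : Fin 2 → ℂ, v ∈ negCone (Jstar.map τ) → J v ∈ C0pm δ)
  (b : ↥(finAdelic (↥(maximalRealSubfield L)) L (IsCMField.complexConj L) 2 Jstar) →* ↥(gspFinAdelic δ))
  (bq : ↥(rational (↥(maximalRealSubfield L)) L (IsCMField.complexConj L) 2 Jstar) →* ↥(gspRational δ))

/-- `N·(k+1)! ∣ N·(k'+1)!` for `k ≤ k'`. [folklore] -/
private theorem mul_factorial_dvd (N : ℕ) {k k' : ℕ} (h : k ≤ k') : N * (k + 1).factorial ∣ N * (k' + 1).factorial :=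
  mul_dvd_mul_left N (Nat.factorial_dvd_factorial (Nat.succ_le_succ h))

/-- **TOWER SEPARATION ([Deligne 1971] Prop. 1.15 at infinite level, for the datum `(J, b)` on the unitary Shimura curve).**  Let
`K ≤ b⁻¹(K_δ(N))` be a compact source level (`N ≠ 0`).  If for EVERY `k` the Siegel classes at the principal level `K_δ(N·(k+1)!)` of `(J v, b a)`
and of `(J v′, b a′ · b u_k)` for SOME `u_k ∈ K` agree, then `[v, aK] = [v′, a′K]` in `Sh_K(U(J⋆), 𝔻)(ℂ)`.  Proof: the rational transporters `γ_k`
all lie in the FINITE set of ★ `finite_setOf_conjAct_eq_and_mem` at level `N`; one of them, `γ₀`, occurs for infinitely many `k`, hence (levels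
decrease along the factorial tower) `b(a)⁻¹ γ₀ b(a′) ∈ K_δ(N(k+1)!)·b(K)` for all `k`; compactness of `b(K)` and `⋂ₖ K_δ(N(k+1)!) = 1`
(★ `mem_of_forall_mem_mul_of_isCompact`, ★ `iInter_principalLevelSubgroup_factorial`) give `b(a)⁻¹ γ₀ b(a′) = b(w)`, `w ∈ K`; so `γ₀` is a rational
point of the image of `b` (`hbrat`): `γ₀ = bq β` with `β_𝔸 = a w a′⁻¹`, and equivariance (`hJrat`) with line separation (`hJinj`) give
`c · β^τ v′ = v`, while `β a′K = a w K = aK`.  Rank-2 twin of ★ `shimuraSet_mk_eq_and_classOf_eq_of_forall_siegel_mk_eq` (torus class dropped).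
[cite: Deligne1971TravauxShimura, Prop. 1.15 p. 132 and 5.4] [cite: Milne2005ShimuraVarieties, Lemma 5.13 p. 57] [cite: Deligne1979ShimuraVarieties, Prop. 2.3.10] -/
theorem gs_mk_eq_of_forall_siegel_mk_eq
    (hJinj : ∀ v : Fin 2 → ℂ, v ∈ negCone (Jstar.map τ) → ∀ v' : Fin 2 → ℂ, v' ∈ negCone (Jstar.map τ) →
      J v = J v' → ∃ c : ℂ, c ≠ 0 ∧ c • v' = v)
    (hJrat : ∀ (γ : ↥(rational (↥(maximalRealSubfield L)) L (IsCMField.complexConj L) 2 Jstar)) (v : Fin 2 → ℂ),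
      v ∈ negCone (Jstar.map τ) →
        J (((ratToGLℂ L Jstar τ γ : GL (Fin 2) ℂ) : Matrix (Fin 2) (Fin 2) ℂ) *ᵥ v) =
          conjJ ((gspRationalToReal δ (bq γ) : ↥(gspReal δ)) : GL (Fin g ⊕ Fin g) ℝ) (J v))
    (hbrat : ∀ (γ : ↥(gspRational δ)) (x : ↥(finAdelic (↥(maximalRealSubfield L)) L (IsCMField.complexConj L) 2 Jstar)),
      gspRationalToFinAdelic δ γ = b x →
        ∃ β : ↥(rational (↥(maximalRealSubfield L)) L (IsCMField.complexConj L) 2 Jstar),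
          x = rationalToFinAdelic (↥(maximalRealSubfield L)) L (IsCMField.complexConj L) 2 Jstar β ∧ γ = bq β)
    (hbcont : Continuous b) (hN : N ≠ 0)
    (K : Subgroup ↥(finAdelic (↥(maximalRealSubfield L)) L (IsCMField.complexConj L) 2 Jstar))
    (hle : K ≤ (principalLevelSubgroup δ N).comap b)
    (hK : IsCompact (K : Set ↥(finAdelic (↥(maximalRealSubfield L)) L (IsCMField.complexConj L) 2 Jstar)))
    {v v' : Fin 2 → ℂ} (hv : v ∈ negCone (Jstar.map τ)) (hv' : v' ∈ negCone (Jstar.map τ))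
    {a a' : ↥(finAdelic (↥(maximalRealSubfield L)) L (IsCMField.complexConj L) 2 Jstar)}
    (h : ∀ k : ℕ, ∃ u ∈ K,
      SiegelShimuraSet.mk δ (principalLevelSubgroup δ (N * (k + 1).factorial)) ⟨J v, hJ v hv⟩ (b a) =
        SiegelShimuraSet.mk δ (principalLevelSubgroup δ (N * (k + 1).factorial)) ⟨J v', hJ v' hv'⟩ (b a' * b u)) :
    ShimuraSetGS.mk L Jstar τ K v hv a = ShimuraSetGS.mk L Jstar τ K v' hv' a' := by
  classical
  set Jx : C0pm δ := ⟨J v, hJ v hv⟩ with hJxdef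
  set Jx' : C0pm δ := ⟨J v', hJ v' hv'⟩ with hJx'def
  set g₁ : ↥(gspFinAdelic δ) := b a with hg₁
  set g₂ : ↥(gspFinAdelic δ) := b a' with hg₂
  -- Step 1: rational transporters `γ k` and level corrections `u k`
  have step1 : ∀ k : ℕ, ∃ γ : ↥(gspRational δ), ∃ u ∈ K, conjAct δ (gspRationalToReal δ γ) Jx' = Jx ∧
      g₁⁻¹ * (gspRationalToFinAdelic δ γ * (g₂ * b u)) ∈ principalLevelSubgroup δ (N * (k + 1).factorial) := by
    intro k
    obtain ⟨u, hu, hk⟩ := h k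
    obtain ⟨γ, hγJ, hq⟩ := (SiegelShimuraSet.mk_eq_mk_iff δ _ Jx Jx' g₁ (g₂ * b u)).1 hk
    refine ⟨γ, u, hu, hγJ, ?_⟩
    rw [MulAction.Quotient.smul_mk, QuotientGroup.eq] at hq
    have := inv_mem hq
    rwa [_root_.mul_inv_rev, inv_inv] at this
  choose γ u hu hγJ hmem using step1
  -- Step 2: the `γ k` lie in a finite set; pigeonhole
  set S := {γ' : ↥(gspRational δ) | conjAct δ (gspRationalToReal δ γ') Jx' = Jx ∧
      (g₁⁻¹ * (gspRationalToFinAdelic δ γ' * g₂) : ↥(gspFinAdelic δ)) ∈ principalLevelSubgroup δ N} with hSdef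
  have hfin : S.Finite := finite_setOf_conjAct_eq_and_mem N Jx Jx' g₁ g₂
  have hγS : ∀ k, γ k ∈ S := by
    intro k
    refine ⟨hγJ k, ?_⟩
    have h1 : g₁⁻¹ * (gspRationalToFinAdelic δ (γ k) * (g₂ * b (u k))) ∈ principalLevelSubgroup δ N :=
      principalLevelSubgroup_anti δ (dvd_mul_right N _) (hmem k)
    have h2 : b (u k) ∈ principalLevelSubgroup δ N := hle (hu k)
    have h3 := mul_mem h1 (inv_mem h2)
    have heq : g₁⁻¹ * (gspRationalToFinAdelic δ (γ k) * (g₂ * b (u k))) * (b (u k))⁻¹ =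
        g₁⁻¹ * (gspRationalToFinAdelic δ (γ k) * g₂) := by group
    rw [heq] at h3
    exact h3
  haveI : Finite S := hfin.to_subtype
  obtain ⟨γS, hγSinf⟩ := Finite.exists_infinite_fiber (fun k : ℕ => (⟨γ k, hγS k⟩ : S))
  set γ₀ : ↥(gspRational δ) := γS.1 with hγ₀def
  have hinf : Set.Infinite {k : ℕ | γ k = γ₀} := by
    have : Set.Infinite ((fun k : ℕ => (⟨γ k, hγS k⟩ : S)) ⁻¹' {γS}) := Set.infinite_coe_iff.1 hγSinf
    refine this.mono fun k hk => ?_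
    have hk' : (⟨γ k, hγS k⟩ : S) = γS := hk
    exact congrArg Subtype.val hk'
  obtain ⟨k₀, hk₀⟩ : ∃ k, γ k = γ₀ := by
    obtain ⟨k, hk, -⟩ := hinf.exists_gt 0
    exact ⟨k, hk⟩
  have hγ₀J : conjAct δ (gspRationalToReal δ γ₀) Jx' = Jx := by rw [← hk₀]; exact hγJ k₀
  -- Step 3: `c = g₁⁻¹ γ₀ g₂` satisfies `c⁻¹ ∈ b(K) · K_δ(N(k+1)!)` for all `k`
  set c : ↥(gspFinAdelic δ) := g₁⁻¹ * (gspRationalToFinAdelic δ γ₀ * g₂) with hcdef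
  set C : Set ↥(gspFinAdelic δ) := b '' (K : Set ↥(finAdelic (↥(maximalRealSubfield L)) L (IsCMField.complexConj L) 2 Jstar))
    with hCdef
  have hCcpt : IsCompact C := hK.image hbcont
  set U : ℕ → Set ↥(gspFinAdelic δ) := fun k =>
    ((principalLevelSubgroup δ (N * (k + 1).factorial) : Subgroup ↥(gspFinAdelic δ)) : Set ↥(gspFinAdelic δ)) with hUdef
  have hUclosed : ∀ k, IsClosed (U k) := fun k =>
    isClosed_principalLevelSubgroup δ (mul_ne_zero hN (Nat.factorial_ne_zero _))
  have hUanti : Antitone U := by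
    intro k k' hkk' y hy
    exact principalLevelSubgroup_anti δ (mul_factorial_dvd N hkk') hy
  have hUone : (⋂ k, U k) = {1} := iInter_principalLevelSubgroup_factorial δ N
  have hcmem : ∀ k, c⁻¹ ∈ C * U k := by
    intro k
    obtain ⟨k', hk'mem, hkk'⟩ := hinf.exists_gt k
    have hk' : γ k' = γ₀ := hk'mem
    have hmem' : c * b (u k') ∈ principalLevelSubgroup δ (N * (k + 1).factorial) := by
      have := principalLevelSubgroup_anti δ (mul_factorial_dvd N hkk'.le) (hmem k')
      rw [hk'] at this
      have heq : g₁⁻¹ * (gspRationalToFinAdelic δ γ₀ * (g₂ * b (u k'))) = c * b (u k') := by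
        rw [hcdef]; group
      rw [heq] at this
      exact this
    refine Set.mem_mul.2 ⟨b (u k'), ⟨u k', hu k', rfl⟩, (c * b (u k'))⁻¹, inv_mem hmem', ?_⟩
    group
  have hcC : c⁻¹ ∈ C :=
    Literature.Topology.Algebra.mem_of_forall_mem_mul_of_isCompact hCcpt hUclosed hUanti hUone hcmem
  obtain ⟨w₀, hw₀, hw₀c⟩ := hcC
  -- `c = b w` with `w = w₀⁻¹ ∈ K`
  obtain ⟨w, hw, hcw⟩ : ∃ w ∈ K, c = b w := ⟨w₀⁻¹, inv_mem hw₀, by rw [map_inv, hw₀c, inv_inv]⟩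
  -- Step 4: `γ₀` is a rational point of the image of `b`
  have hγ₀f : gspRationalToFinAdelic δ γ₀ = b (a * w * a'⁻¹) := by
    rw [map_mul, map_mul, map_inv, ← hcw, hcdef]
    change gspRationalToFinAdelic δ γ₀ = g₁ * (g₁⁻¹ * (gspRationalToFinAdelic δ γ₀ * g₂)) * g₂⁻¹
    group
  obtain ⟨β, hβ, hβγ⟩ := hbrat γ₀ (a * w * a'⁻¹) hγ₀f
  -- Step 5: `J (β^τ v') = J v`, hence `c • β^τ v' = v`
  have hJeq : J v = J (((ratToGLℂ L Jstar τ β : GL (Fin 2) ℂ) : Matrix (Fin 2) (Fin 2) ℂ) *ᵥ v') := by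
    rw [hJrat β v' hv', ← hβγ]
    have := congrArg Subtype.val hγ₀J
    simpa only [coe_conjAct] using this.symm
  have hβv' : ((ratToGLℂ L Jstar τ β : GL (Fin 2) ℂ) : Matrix (Fin 2) (Fin 2) ℂ) *ᵥ v' ∈ negCone (Jstar.map τ) := by
    simpa only [one_smul] using smul_ratToGLℂ_mulVec_mem_negCone L Jstar τ β one_ne_zero hv'
  obtain ⟨c', hc', hc'v⟩ := hJinj v hv _ hβv' hJeq
  -- Step 6: the classes agree
  refine (ShimuraSetGS.mk_eq_mk_iff L Jstar τ K v v' hv hv' a a').2 ⟨β, c', hc', hc'v, ?_⟩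
  rw [← hβ, MulAction.Quotient.smul_mk, smul_eq_mul, QuotientGroup.eq]
  have heq : (a * w * a'⁻¹ * a')⁻¹ * a = w⁻¹ := by group
  rw [heq]
  exact inv_mem hw

/-- **Tower separation, `u_k = 1` form**: if the Siegel classes of `(J v, b a)` and `(J v′, b a′)` agree at EVERY principal level
`K_δ(N·(k+1)!)`, then `[v, aK] = [v′, a′K]`. [cite: Deligne1971TravauxShimura, Prop. 1.15 p. 132] [cite: Milne2005ShimuraVarieties, Lemma 5.13 p. 57] -/
theorem gs_mk_eq_of_forall_siegel_mk_eq'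
    (hJinj : ∀ v : Fin 2 → ℂ, v ∈ negCone (Jstar.map τ) → ∀ v' : Fin 2 → ℂ, v' ∈ negCone (Jstar.map τ) →
      J v = J v' → ∃ c : ℂ, c ≠ 0 ∧ c • v' = v)
    (hJrat : ∀ (γ : ↥(rational (↥(maximalRealSubfield L)) L (IsCMField.complexConj L) 2 Jstar)) (v : Fin 2 → ℂ),
      v ∈ negCone (Jstar.map τ) →
        J (((ratToGLℂ L Jstar τ γ : GL (Fin 2) ℂ) : Matrix (Fin 2) (Fin 2) ℂ) *ᵥ v) =
          conjJ ((gspRationalToReal δ (bq γ) : ↥(gspReal δ)) : GL (Fin g ⊕ Fin g) ℝ) (J v))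
    (hbrat : ∀ (γ : ↥(gspRational δ)) (x : ↥(finAdelic (↥(maximalRealSubfield L)) L (IsCMField.complexConj L) 2 Jstar)),
      gspRationalToFinAdelic δ γ = b x →
        ∃ β : ↥(rational (↥(maximalRealSubfield L)) L (IsCMField.complexConj L) 2 Jstar),
          x = rationalToFinAdelic (↥(maximalRealSubfield L)) L (IsCMField.complexConj L) 2 Jstar β ∧ γ = bq β)
    (hbcont : Continuous b) (hN : N ≠ 0)
    (K : Subgroup ↥(finAdelic (↥(maximalRealSubfield L)) L (IsCMField.complexConj L) 2 Jstar))
    (hle : K ≤ (principalLevelSubgroup δ N).comap b)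
    (hK : IsCompact (K : Set ↥(finAdelic (↥(maximalRealSubfield L)) L (IsCMField.complexConj L) 2 Jstar)))
    {v v' : Fin 2 → ℂ} (hv : v ∈ negCone (Jstar.map τ)) (hv' : v' ∈ negCone (Jstar.map τ))
    {a a' : ↥(finAdelic (↥(maximalRealSubfield L)) L (IsCMField.complexConj L) 2 Jstar)}
    (h : ∀ k : ℕ,
      SiegelShimuraSet.mk δ (principalLevelSubgroup δ (N * (k + 1).factorial)) ⟨J v, hJ v hv⟩ (b a) =
        SiegelShimuraSet.mk δ (principalLevelSubgroup δ (N * (k + 1).factorial)) ⟨J v', hJ v' hv'⟩ (b a')) :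
    ShimuraSetGS.mk L Jstar τ K v hv a = ShimuraSetGS.mk L Jstar τ K v' hv' a' :=
  gs_mk_eq_of_forall_siegel_mk_eq J hJ b bq hJinj hJrat hbrat hbcont hN K hle hK hv hv'
    fun k => ⟨1, one_mem K, by rw [map_one, mul_one]; exact h k⟩

/-- **The class maps along the factorial tower JOINTLY separate points** (the `⋂ₖ R_k = Δ` input of Deligne's stationarity ★
`Motives.exists_injective_map_of_iInter_eq_diagonal`): for any family `φ_k : Sh_K(U(J⋆), 𝔻)(ℂ) → Sh_{K_δ(N(k+1)!)}(GSp_δ, S^±)(ℂ)` acting by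
FILE A's formula `φ_k [v, aK] = [J(v), b(a)·K_δ(N(k+1)!)]` (★ `exists_siegelPointMapGS` at the levels `N(k+1)!`, all below `K` since
`K_δ(N(k+1)!) ≤ K_δ(N)`), `φ_k x = φ_k y` for all `k` forces `x = y`. [cite: Deligne1971TravauxShimura, Prop. 1.15 and Lemme 1.15.3 p. 132] -/
theorem eq_of_forall_siegelPointMap_eq
    (hJinj : ∀ v : Fin 2 → ℂ, v ∈ negCone (Jstar.map τ) → ∀ v' : Fin 2 → ℂ, v' ∈ negCone (Jstar.map τ) →
      J v = J v' → ∃ c : ℂ, c ≠ 0 ∧ c • v' = v)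
    (hJrat : ∀ (γ : ↥(rational (↥(maximalRealSubfield L)) L (IsCMField.complexConj L) 2 Jstar)) (v : Fin 2 → ℂ),
      v ∈ negCone (Jstar.map τ) →
        J (((ratToGLℂ L Jstar τ γ : GL (Fin 2) ℂ) : Matrix (Fin 2) (Fin 2) ℂ) *ᵥ v) =
          conjJ ((gspRationalToReal δ (bq γ) : ↥(gspReal δ)) : GL (Fin g ⊕ Fin g) ℝ) (J v))
    (hbrat : ∀ (γ : ↥(gspRational δ)) (x : ↥(finAdelic (↥(maximalRealSubfield L)) L (IsCMField.complexConj L) 2 Jstar)),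
      gspRationalToFinAdelic δ γ = b x →
        ∃ β : ↥(rational (↥(maximalRealSubfield L)) L (IsCMField.complexConj L) 2 Jstar),
          x = rationalToFinAdelic (↥(maximalRealSubfield L)) L (IsCMField.complexConj L) 2 Jstar β ∧ γ = bq β)
    (hbcont : Continuous b) (hN : N ≠ 0)
    (K : Subgroup ↥(finAdelic (↥(maximalRealSubfield L)) L (IsCMField.complexConj L) 2 Jstar))
    (hle : K ≤ (principalLevelSubgroup δ N).comap b)
    (hK : IsCompact (K : Set ↥(finAdelic (↥(maximalRealSubfield L)) L (IsCMField.complexConj L) 2 Jstar)))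
    (φ : ∀ k : ℕ, ShimuraSetGS L Jstar τ K → SiegelShimuraSet δ (principalLevelSubgroup δ (N * (k + 1).factorial)))
    (hφ : ∀ (k : ℕ) (v : Fin 2 → ℂ) (hv : v ∈ negCone (Jstar.map τ))
      (a : ↥(finAdelic (↥(maximalRealSubfield L)) L (IsCMField.complexConj L) 2 Jstar)),
      φ k (ShimuraSetGS.mk L Jstar τ K v hv a) =
        SiegelShimuraSet.mk δ (principalLevelSubgroup δ (N * (k + 1).factorial)) ⟨J v, hJ v hv⟩ (b a))
    {x y : ShimuraSetGS L Jstar τ K} (hxy : ∀ k, φ k x = φ k y) : x = y := by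
  obtain ⟨v, hv, a, rfl⟩ := ShimuraSetGS.mk_surjective L Jstar τ K x
  obtain ⟨v', hv', a', rfl⟩ := ShimuraSetGS.mk_surjective L Jstar τ K y
  exact gs_mk_eq_of_forall_siegel_mk_eq' J hJ b bq hJinj hJrat hbrat hbcont hN K hle hK hv hv'
    fun k => by rw [← hφ k v hv a, ← hφ k v' hv' a']; exact hxy k

end UnitaryCurve

end Literature.AlgebraicGeometry.ShimuraVarieties

end
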